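import Literature.AlgebraicGeometry.Motives.HodgeStructureHodgeClassesHardLefschetz
import Literature.AlgebraicGeometry.Motives.HodgeStructureLefschetzGroupInvariantsHodgeClasses
import HarnessLib

/-!
# Milne 1999, Prop. 5.2 / Cor. 5.3 (a) on the carrier: the Lefschetz components of a divisor class are divisor
# classes (`S(H)(ℂ)`-equivariance of the Lefschetz decomposition), hard Lefschetz `E^{g-2p} ∧ · : Dᵖ(H) ≅ D^{g-p}(H)`,
# `d_p = d_{g-p}`, and `D_hom = D_num`: for `0 ≠ x ∈ Dᵖ(H)` there is `y ∈ D^{g-p}(H)` with `x ∧ y ≠ 0`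

[topic AlgebraicGeometry/Motives]

Layer `Literature/AlgebraicGeometry/Motives`, lane `lit-hodgefound` (Track 2 foundations library; prover seat `lit-hodgefound-p34`,
generation 28, row g28-#8). THEOREMS ONLY (no `def`, no named fact, no instance, no notation; net debt `0`). Sequel of the
seat's g28-#7 `Motives/HodgeStructureHodgeClassesHardLefschetz` (the same statements for the Hodge classes `Bᵖ`, `Lʲ(Dᵖ) ⊆ D^{p+j}`,
`d_p ≤ d_{g-p}`) and of g26-#1 `Motives/HodgeStructureLefschetzGroupInvariantsHodgeClasses` (Milne's Cor. 4.5 on the carrier: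
`x ∈ Dᵖ(H) ⟺ Θ x` is fixed by every `γ ∈ S(H)(ℂ)`, `Θ = toComplexAlg V`), using the tree's Lefschetz decomposition in the
exterior algebra (`IsSymplectic.exists_sum_pow_mul_primitive` / `…eq_zero_of_sum_pow_mul_primitive_eq_zero`, `map_mem_primitive`,
`Motives/HodgeStructureExteriorPowerLefschetz{,Dual}`), its Hodge-theoretic projections `Q.lefschetzProj`
(`Motives/HodgeStructureExteriorPowerLefschetzPolarization`) and the complexification `toComplexAlg`
(`Motives/HodgeStructureExteriorPowerHodgeRiemann`).

## The source, verbatim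

J. S. Milne, *Lefschetz classes on abelian varieties*, Duke Math. J. 96 (1999) [Milne1999LefschetzClasses], §5 (pp. 662–663):
"**Proposition 5.1.** For any abelian variety `A`, `D_hom(A)_k` is a graded subalgebra of `H^{2*}(A)(*)` […] Since the action of
`w(𝔾_m)` commutes with that of `S(A)`, this shows that if `α` is fixed by `S(A)` then so also are the `α_r`.
**Proposition 5.2.** Let `A` be an abelian variety over `Ω`. For any nonzero `a ∈ D^s_hom(A)_k`, there exists `b ∈ D^{g-s}_hom(A)_k`
such that `a · b ≠ 0`. *Proof.* Because `L(A)` acts semisimply, the nondegenerate pairing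
`H^{2s}(A)(s) × H^{2g-2s}(A)(g-s) → H^{2g}(A)(g) ≅ k`, `g = dim A`, induces a nondegenerate pairing
`H^{2s}(A)(s)^{L(A)} × H^{2g-2s}(A)(g-s)^{L(A)} → k` [`= D^s × D^{g-s}`]. **Corollary 5.3.** (a) The canonical map
`D^s_hom(A) → D^s_num(A)` is bijective." H. Lange, *Abelian Varieties over the Complex Numbers* (2023)
[Lange2023AbelianVarietiesComplex], §7.3.2 (p. 338): "(1) `L^{g-k} : ⋀ᵏV → ⋀^{2g-k}V` is an isomorphism of
`Sp(V, E)`-representations […] (3) `⋀ᵏV = Pᵏ ⊕ LP^{k-2} ⊕ L²P^{k-4} ⊕ ⋯` […] the decomposition of `⋀ᵏV` into irreducible `Sp(V, E)`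
subrepresentations".

## Reading on the carrier, and what is PROVED

`H` a `ℚ`-Hodge structure of odd weight `n` on `V`, `dim V = 2g`, `Q` a polarization, `E = E_Q = Q.lefschetzClass`, `Θ = toComplexAlg V`,
`S(H)(ℂ) = Q.lefschetzGroupBaseChange ℂ ⊆ Sp(Q_ℂ)`, `π_r = Q.lefschetzProj … r` the projection of `⋀ᵏ H` onto `Lʳ P^{k-2r}`,
`Dᵖ(H) = H.divisorClasses p`, `d_p = dim Dᵖ(H)`. Here Milne's semisimplicity argument is REPLACED by the `Sp`-equivariance of the
Lefschetz decomposition (Lange's (1)–(3)) and the positivity of the polarization of `⋀ᵏ H` on Hodge classes (g28-#7):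

* §1 (no Hodge group needed) `Polarization.isSymplectic_toComplexAlg_lefschetzClass` (`Θ E` is symplectic of genus `g` over `ℂ`),
  `toComplexAlg_mem_primitive` (`Θ Pᵏ_ℚ ⊆ Pᵏ_ℂ`), **`Polarization.map_toComplexAlg_lefschetzProj_eq`**: if a `ℂ`-linear `γ` of `V_ℂ`
  has `⋀(γ)` fixing `Θ E` and `Θ x` (`x ∈ ⋀ᵏ V`, `k ≤ g`), then `⋀(γ)` fixes every `Θ(π_r x)` (uniqueness of the Lefschetz
  decomposition over `ℂ`, `⋀(γ) Pᵐ_ℂ ⊆ Pᵐ_ℂ`); `Polarization.map_toComplexAlg_eq_of_lefschetzPow` (`⋀(γ)` fixes `Θ(Eʲ ∧ x)`,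
  `k + j ≤ g` ⟹ it fixes `Θ x`: injectivity of `Lʲ` over `ℂ`); `Polarization.lefschetzForm_sum_smul_lefschetzProj`
  (`Q_k(x, Σ_r (-1)^{k(k-1)/2+r} π_r x) = (-1)ᵏ P(x, x)`, `P` the form of `Q.exteriorPower`).
* §2 (through Cor. 4.5) `Polarization.map_toComplexAlg_lefschetzClass_eq_of_mem_lefschetzGroupBaseChange`
  (`S(H)(ℂ)` fixes `Θ E`, as `E ∈ D¹`), **`Polarization.lefschetzProj_apply_mem_divisorClasses`** (THE LEFSCHETZ COMPONENTS OF A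
  DIVISOR CLASS ARE DIVISOR CLASSES: `π_r Dᵖ ⊆ Dᵖ`, `2p ≤ g` — Prop. 5.1's "if `α` is fixed by `S(A)` then so are the `α_r`" for the
  Lefschetz grading), `Polarization.sum_smul_lefschetzProj_mem_divisorClasses`, **`Polarization.mem_divisorClasses_of_lefschetzPow_mem`**
  (`Eʲ ∧ x ∈ D^{p+j}`, `2p + j ≤ g` ⟹ `x ∈ Dᵖ`), **HARD LEFSCHETZ FOR DIVISOR CLASSES `Eʲ ∧ Dᵖ = D^{g-p}` for `2p + j = g`**
  (`Polarization.map_lefschetzPow_divisorClasses_eq`; "(1) is an isomorphism of `Sp(V, E)`-representations"), **`d_p = d_{g-p}`**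
  (`Polarization.finrank_divisorClasses_eq_of_le`); **MILNE PROP. 5.2** `Polarization.exists_mem_divisorClasses_mul_ne_zero`
  (`p ≤ g`, `0 ≠ x ∈ Dᵖ ⟹ ∃ y ∈ D^{g-p}, x ∧ y ≠ 0` in `⋀^{2g} V ≅ ℚ`: below the middle `y = E^{g-2p} ∧ Σ_r ± π_r x`, above it one
  descends `x = E^{2p-g} ∧ x'`, `x' ∈ D^{g-p}`), **COR. 5.3 (a) `D_hom = D_num`** `Polarization.eq_zero_of_forall_mul_divisorClasses_eq_zero`.

## References

* [Milne1999LefschetzClasses] J. S. Milne, *Lefschetz classes on abelian varieties*, Duke Math. J. 96 (1999), §5 Prop. 5.1, Prop. 5.2,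
  Cor. 5.3 (a) (pp. 662–663); §4 Cor. 4.5 (p. 659).
* [Lange2023AbelianVarietiesComplex] H. Lange, *Abelian Varieties over the Complex Numbers* (2023), §7.3.2 (1)–(3) (p. 338).
* [Deligne1982HodgeCycles] P. Deligne, *Hodge cycles on abelian varieties*, LNM 900 (1982), I §2, 2.1 (c) and Prop. 2.9 (b)(iii).
* [Voisin2002] C. Voisin, *Hodge Theory and Complex Algebraic Geometry I* (2002), Prop. 6.22, Lemma 6.31.
-/

noncomputable section

open scoped TensorProduct

namespace Literature.AlgebraicGeometry.Motives.HodgeStructure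

open ExteriorLefschetz ExteriorAlgebra

universe u

/-! ## §1 `Sp`-equivariance of the Lefschetz decomposition after complexification -/

section General

variable {V : Type u} [AddCommGroup V] [Module ℚ V]

/-- **Primitive classes complexify to primitive classes**: `Θ(Pᵏ_ℚ(ω)) ⊆ Pᵏ_ℂ(Θ ω)` (`Θ = toComplexAlg V` is a ring map into
`⋀_ℂ V_ℂ` carrying `⋀ᵏ_ℚ` into `⋀ᵏ_ℂ`). [cite: Lange2023AbelianVarietiesComplex, §7.3.2 (p. 338)] [cite: BourbakiAlgebre1a3, Ch. III §7 no. 5 Prop. 8] -/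
theorem toComplexAlg_mem_primitive {ω : ExteriorAlgebra ℚ V} {g k : ℕ} {p : ExteriorAlgebra ℚ V} (hp : p ∈ ExteriorLefschetz.primitive ω g k) :
    toComplexAlg V p ∈ ExteriorLefschetz.primitive (toComplexAlg V ω) g k := by
  obtain ⟨hpk, hp0⟩ := mem_primitive_iff.mp hp
  refine mem_primitive_iff.mpr ⟨toComplexAlg_mem V hpk, ?_⟩
  rw [← map_pow, ← map_mul, hp0, map_zero]

end General

section Equivariance

variable {V : Type u} [AddCommGroup V] [Module ℚ V] [Module.Finite ℚ V] {n : ℤ} {H : HodgeStructure V n}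
  (Q : Polarization H) (hn : Odd n) {g : ℕ} (hg : Module.finrank ℚ V = 2 * g)

include hn hg in
/-- **The complexified class `Θ E_Q ∈ ⋀² V_ℂ` is symplectic of genus `g`** (it is the 2-vector of the complexified form, which is
non-degenerate and alternating, `dim_ℂ V_ℂ = 2g`). [cite: Lange2023AbelianVarietiesComplex, §7.3.2 (p. 338)] -/
theorem Polarization.isSymplectic_toComplexAlg_lefschetzClass :
    IsSymplectic (toComplexAlg V (Q.lefschetzClass : ExteriorAlgebra ℚ V)) g := by
  rw [Polarization.coe_lefschetzClass, toComplexAlg_twoVectorOfForm Q.nondegenerate Q.nondegenerate_baseChange]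
  exact isSymplectic_twoVectorOfForm Q.nondegenerate_baseChange (Q.isAlt_baseChange_of_odd hn)
    (by rw [Module.finrank_baseChange, hg])

/-- **Equivariance of the Lefschetz projections**: if `γ ∈ GL(V_ℂ)` has `⋀(γ)(Θ E) = Θ E` and `⋀(γ)(Θ x) = Θ x` for an `x ∈ ⋀ᵏ V`,
`k ≤ g`, then `⋀(γ)` fixes the complexification `Θ(π_r x)` of every Lefschetz component `π_r x = Eʳ ∧ x_r` of `x` — `⋀(γ)` maps
primitive classes to primitive classes, so `Σ_r (Θ E)ʳ (⋀(γ) Θ x_r - Θ x_r) = ⋀(γ) Θ x - Θ x = 0` is a Lefschetz decomposition of `0`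
over `ℂ`, whose components vanish (uniqueness): the summands of "(3) `⋀ᵏV = Pᵏ ⊕ LP^{k-2} ⊕ ⋯`" are `Sp(V, E)`-subrepresentations.
[cite: Lange2023AbelianVarietiesComplex, §7.3.2 (1)–(3) (p. 338)] [cite: Voisin2002, Prop. 6.22] -/
theorem Polarization.map_toComplexAlg_lefschetzProj_eq {k : ℕ} (hk : k ≤ g) (γ : ℂ ⊗[ℚ] V →ₗ[ℂ] ℂ ⊗[ℚ] V)
    (hγE : ExteriorAlgebra.map γ (toComplexAlg V (Q.lefschetzClass : ExteriorAlgebra ℚ V)) =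
      toComplexAlg V (Q.lefschetzClass : ExteriorAlgebra ℚ V))
    {x : ⋀[ℚ]^k V} (hγx : ExteriorAlgebra.map γ (toComplexAlg V (x : ExteriorAlgebra ℚ V)) = toComplexAlg V (x : ExteriorAlgebra ℚ V))
    (r : ℕ) :
    ExteriorAlgebra.map γ (toComplexAlg V (((Q.lefschetzProj hn hg hk r).toLinearMap x : ⋀[ℚ]^k V) : ExteriorAlgebra ℚ V)) =
      toComplexAlg V (((Q.lefschetzProj hn hg hk r).toLinearMap x : ⋀[ℚ]^k V) : ExteriorAlgebra ℚ V) := by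
  have hω : IsSymplectic (Q.lefschetzClass : ExteriorAlgebra ℚ V) g := Q.isSymplectic_lefschetzClass hn hg
  have hωC := Q.isSymplectic_toComplexAlg_lefschetzClass hn hg
  by_cases hr : r ∈ Finset.range (k / 2 + 1)
  swap
  · rw [Q.lefschetzProj_eq_zero hn hg hk (by rw [Finset.mem_range] at hr; omega), Hom.zero_toLinearMap, LinearMap.zero_apply,
      ZeroMemClass.coe_zero, map_zero, map_zero]
  obtain ⟨φ, hφ, -, hxdec⟩ := hω.exists_sum_pow_mul_primitive hk x.2
  have hφ' : ∀ s ∈ Finset.range (k / 2 + 1),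
      φ s ∈ ExteriorLefschetz.primitive (Q.lefschetzClass : ExteriorAlgebra ℚ V) g (k - 2 * s) := fun s _ ↦ hφ s
  -- the complexified components, moved by `γ`, minus themselves: a Lefschetz decomposition of `0`
  have hψ : ∀ s ∈ Finset.range (k / 2 + 1),
      ExteriorAlgebra.map γ (toComplexAlg V (φ s)) - toComplexAlg V (φ s) ∈
        ExteriorLefschetz.primitive (toComplexAlg V (Q.lefschetzClass : ExteriorAlgebra ℚ V)) g (k - 2 * s) := fun s _ ↦
    Submodule.sub_mem _ (map_mem_primitive γ hγE (toComplexAlg_mem_primitive (hφ s))) (toComplexAlg_mem_primitive (hφ s))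
  have h1 : toComplexAlg V (x : ExteriorAlgebra ℚ V) = ∑ s ∈ Finset.range (k / 2 + 1),
      toComplexAlg V (Q.lefschetzClass : ExteriorAlgebra ℚ V) ^ s * toComplexAlg V (φ s) := by
    rw [hxdec, map_sum]
    simp only [map_mul, map_pow]
  have h2 : ExteriorAlgebra.map γ (toComplexAlg V (x : ExteriorAlgebra ℚ V)) = ∑ s ∈ Finset.range (k / 2 + 1),
      toComplexAlg V (Q.lefschetzClass : ExteriorAlgebra ℚ V) ^ s * ExteriorAlgebra.map γ (toComplexAlg V (φ s)) := by
    rw [h1, map_sum]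
    simp only [map_mul, map_pow, hγE]
  have hsum : ∑ s ∈ Finset.range (k / 2 + 1), toComplexAlg V (Q.lefschetzClass : ExteriorAlgebra ℚ V) ^ s *
      (ExteriorAlgebra.map γ (toComplexAlg V (φ s)) - toComplexAlg V (φ s)) = 0 := by
    simp only [mul_sub, Finset.sum_sub_distrib, ← h1, ← h2, hγx, sub_self]
  have hfix : ExteriorAlgebra.map γ (toComplexAlg V (φ r)) = toComplexAlg V (φ r) :=
    sub_eq_zero.mp (hωC.eq_zero_of_sum_pow_mul_primitive_eq_zero hk hψ hsum r hr)
  rw [Q.coe_lefschetzProj_apply_of_lefschetzDecomposition hn hg hk hφ' hxdec hr, map_mul, map_pow, map_mul, map_pow, hγE, hfix]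

include hn hg in
/-- **Descent along `Lʲ`**: if `⋀(γ)` fixes `Θ E` and `Θ(Eʲ ∧ x)` for `x ∈ ⋀ᵏ V` with `k + j ≤ g`, then `⋀(γ)` fixes `Θ x`
(`(Θ E)ʲ ∧ (⋀(γ) Θ x - Θ x) = 0` and `Lʲ` is injective on `⋀ᵏ V_ℂ` below the middle — "(1) is an isomorphism of
`Sp(V, E)`-representations"). [cite: Lange2023AbelianVarietiesComplex, §7.3.2 (1) (p. 338)] -/
theorem Polarization.map_toComplexAlg_eq_of_lefschetzPow {k j m : ℕ} (hkj : k + j ≤ g) (h : 2 * j + k = m)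
    (γ : ℂ ⊗[ℚ] V →ₗ[ℂ] ℂ ⊗[ℚ] V)
    (hγE : ExteriorAlgebra.map γ (toComplexAlg V (Q.lefschetzClass : ExteriorAlgebra ℚ V)) =
      toComplexAlg V (Q.lefschetzClass : ExteriorAlgebra ℚ V))
    {x : ⋀[ℚ]^k V}
    (hγx : ExteriorAlgebra.map γ (toComplexAlg V
        ((lefschetzPow (Q.lefschetzClass : ExteriorAlgebra ℚ V) Q.lefschetzClass.2 j h x : ⋀[ℚ]^m V) : ExteriorAlgebra ℚ V)) =
      toComplexAlg V ((lefschetzPow (Q.lefschetzClass : ExteriorAlgebra ℚ V) Q.lefschetzClass.2 j h x : ⋀[ℚ]^m V) :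
        ExteriorAlgebra ℚ V)) :
    ExteriorAlgebra.map γ (toComplexAlg V (x : ExteriorAlgebra ℚ V)) = toComplexAlg V (x : ExteriorAlgebra ℚ V) := by
  have hωC := Q.isSymplectic_toComplexAlg_lefschetzClass hn hg
  rw [lefschetzPow_apply_coe, map_mul, map_pow, map_mul, map_pow, hγE] at hγx
  have hdiff : toComplexAlg V (Q.lefschetzClass : ExteriorAlgebra ℚ V) ^ j *
      (ExteriorAlgebra.map γ (toComplexAlg V (x : ExteriorAlgebra ℚ V)) - toComplexAlg V (x : ExteriorAlgebra ℚ V)) = 0 := by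
    rw [mul_sub, hγx, sub_self]
  have hmem : ExteriorAlgebra.map γ (toComplexAlg V (x : ExteriorAlgebra ℚ V)) - toComplexAlg V (x : ExteriorAlgebra ℚ V) ∈
      ⋀[ℂ]^k (ℂ ⊗[ℚ] V) :=
    Submodule.sub_mem _ (map_mem_exteriorPower γ (toComplexAlg_mem V x.2)) (toComplexAlg_mem V x.2)
  exact sub_eq_zero.mp (hωC.eq_zero_of_pow_mul_eq_zero hkj hmem hdiff)

/-- **`Q_k(x, Σ_r (-1)^{k(k-1)/2+r} π_r x) = (-1)ᵏ P(x, x)`**, `P = Σ_r (-1)^{k(k-1)/2+r} Q_k(π_r ·, ·)` the polarization form of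
`Q.exteriorPower` (`Q_k`-orthogonality of the Lefschetz decomposition and `Q_k(y, x) = (-1)ᵏ Q_k(x, y)`).
[cite: Voisin2002, Lemma 6.31] [cite: Lange2023AbelianVarietiesComplex, §5.4.1 (5.24)] -/
theorem Polarization.lefschetzForm_sum_smul_lefschetzProj {k : ℕ} (hk : k ≤ g) (x : ⋀[ℚ]^k V) :
    lefschetzForm (Q.lefschetzClass : ExteriorAlgebra ℚ V) g k x
        (∑ r ∈ Finset.range (k / 2 + 1), ((-1 : ℚ) ^ (k * (k - 1) / 2 + r)) • (Q.lefschetzProj hn hg hk r).toLinearMap x) =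
      (-1 : ℚ) ^ k * (Q.exteriorPower hn hg hk).form x x := by
  rw [Q.exteriorPower_form hn hg hk, Q.totalLefschetzForm_apply_eq_sum_left hn hg hk, map_sum, Finset.mul_sum]
  refine Finset.sum_congr rfl fun r _ ↦ ?_
  rw [map_smul, smul_eq_mul, lefschetzForm_swap _ g k ((Q.lefschetzProj hn hg hk r).toLinearMap x) x]
  ring

end Equivariance

/-! ## §2 Divisor classes: Lefschetz components, hard Lefschetz, Milne's Prop. 5.2 and Cor. 5.3 (a) -/

section DivisorClasses

variable {V : Type u} [AddCommGroup V] [Module ℚ V] [Module.Finite ℚ V] {n : ℤ}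
  {H : HodgeStructure V n} (Q : Polarization H) (hn : Odd n) {g : ℕ} (hg : Module.finrank ℚ V = 2 * g)

include hn in
/-- **`S(H)(ℂ)` fixes `Θ E_Q`** (`E_Q ∈ D¹(H)` and Milne's Cor. 4.5: the complexification of a divisor class is fixed by `S(H)(ℂ)`).
[cite: Milne1999LefschetzClasses, §4 Cor. 4.5 (p. 659)] -/
theorem Polarization.map_toComplexAlg_lefschetzClass_eq_of_mem_lefschetzGroupBaseChange {γ : (ℂ ⊗[ℚ] V) ≃ₗ[ℂ] (ℂ ⊗[ℚ] V)}
    (hγ : γ ∈ Q.lefschetzGroupBaseChange ℂ) :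
    ExteriorAlgebra.map (γ : ℂ ⊗[ℚ] V →ₗ[ℂ] ℂ ⊗[ℚ] V) (toComplexAlg V (Q.lefschetzClass : ExteriorAlgebra ℚ V)) =
      toComplexAlg V (Q.lefschetzClass : ExteriorAlgebra ℚ V) := by
  have h := (Q.forall_lefschetzGroupBaseChange_map_toComplexAlg_eq_iff_mem_divisorClasses hn (powOf Q.lefschetzClass 1 rfl)).2
    (powOf_mem_divisorClasses H Q.lefschetzClass_mem_hodgeClasses 1) γ hγ
  rwa [coe_powOf, pow_one] at h

/-- **THE LEFSCHETZ COMPONENTS OF A DIVISOR CLASS ARE DIVISOR CLASSES: `π_r(Dᵖ) ⊆ Dᵖ`** (`2p ≤ g`): `Θ(π_r x)` is fixed by `S(H)(ℂ)`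
whenever `Θ x` is (§1), and "fixed by `S` ⟺ divisor class" (Cor. 4.5) — Milne's "if `α` is fixed by `S(A)` then so also are the
`α_r`", for the Lefschetz grading. [cite: Milne1999LefschetzClasses, §5 Prop. 5.1 (proof) and §4 Cor. 4.5]
[cite: Lange2023AbelianVarietiesComplex, §7.3.2 (3) (p. 338)] -/
theorem Polarization.lefschetzProj_apply_mem_divisorClasses {p : ℕ} (hk : 2 * p ≤ g) {x : ⋀[ℚ]^(2 * p) V}
    (hx : x ∈ H.divisorClasses p) (r : ℕ) : (Q.lefschetzProj hn hg hk r).toLinearMap x ∈ H.divisorClasses p := by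
  refine (Q.forall_lefschetzGroupBaseChange_map_toComplexAlg_eq_iff_mem_divisorClasses hn _).1 fun γ hγ ↦ ?_
  exact Q.map_toComplexAlg_lefschetzProj_eq hn hg hk _ (Q.map_toComplexAlg_lefschetzClass_eq_of_mem_lefschetzGroupBaseChange hn hγ)
    ((Q.forall_lefschetzGroupBaseChange_map_toComplexAlg_eq_iff_mem_divisorClasses hn x).2 hx γ hγ) r

/-- **`Σ_r (-1)^{k(k-1)/2+r} π_r x ∈ Dᵖ` for `x ∈ Dᵖ`** (`k = 2p ≤ g`). [cite: Milne1999LefschetzClasses, §5 Prop. 5.1 (proof) and Prop. 5.2] -/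
theorem Polarization.sum_smul_lefschetzProj_mem_divisorClasses {p : ℕ} (hk : 2 * p ≤ g) {x : ⋀[ℚ]^(2 * p) V}
    (hx : x ∈ H.divisorClasses p) :
    (∑ r ∈ Finset.range (2 * p / 2 + 1), ((-1 : ℚ) ^ (2 * p * (2 * p - 1) / 2 + r)) • (Q.lefschetzProj hn hg hk r).toLinearMap x) ∈
      H.divisorClasses p :=
  Submodule.sum_mem _ fun r _ ↦ Submodule.smul_mem _ _ (Q.lefschetzProj_apply_mem_divisorClasses hn hg hk hx r)

include hn hg in
/-- **Descent of divisor classes along `Lʲ`: `Eʲ ∧ x ∈ D^q`, `x ∈ ⋀^{2p} V`, `2p + j ≤ g` ⟹ `x ∈ Dᵖ`** (`Θ x` is fixed by `S(H)(ℂ)` as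
soon as `Θ(Eʲ ∧ x)` is, §1; Cor. 4.5). [cite: Milne1999LefschetzClasses, §4 Cor. 4.5 (p. 659)] [cite: Lange2023AbelianVarietiesComplex, §7.3.2 (1) (p. 338)] -/
theorem Polarization.mem_divisorClasses_of_lefschetzPow_mem {p j q : ℕ} (hpj : 2 * p + j ≤ g) (h : 2 * j + 2 * p = 2 * q)
    {x : ⋀[ℚ]^(2 * p) V}
    (hx : lefschetzPow (Q.lefschetzClass : ExteriorAlgebra ℚ V) Q.lefschetzClass.2 j h x ∈ H.divisorClasses q) :
    x ∈ H.divisorClasses p := by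
  refine (Q.forall_lefschetzGroupBaseChange_map_toComplexAlg_eq_iff_mem_divisorClasses hn x).1 fun γ hγ ↦ ?_
  exact Q.map_toComplexAlg_eq_of_lefschetzPow hn hg hpj h _
    (Q.map_toComplexAlg_lefschetzClass_eq_of_mem_lefschetzGroupBaseChange hn hγ)
    ((Q.forall_lefschetzGroupBaseChange_map_toComplexAlg_eq_iff_mem_divisorClasses hn _).2 hx γ hγ)

include hn hg in
/-- **HARD LEFSCHETZ FOR DIVISOR CLASSES: `Eʲ ∧ Dᵖ(H) = D^q(H)` for `2p + j = g` (`q = p + j = g - p`)** — `⊆` by `D•` being a ring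
containing `E` (g28-#7), `⊇` by hard Lefschetz on `⋀^{2p} V` and descent. [cite: Lange2023AbelianVarietiesComplex, §7.3.2 (1) (p. 338)]
[cite: Milne1999LefschetzClasses, §4 Cor. 4.5 and §5 Prop. 5.2] -/
theorem Polarization.map_lefschetzPow_divisorClasses_eq {p j q : ℕ} (hpj : 2 * p + j = g) (h : 2 * j + 2 * p = 2 * q) :
    (H.divisorClasses p).map (lefschetzPow (Q.lefschetzClass : ExteriorAlgebra ℚ V) Q.lefschetzClass.2 j h) =
      H.divisorClasses q := by
  refine le_antisymm (map_lefschetzPow_divisorClasses_le H Q.lefschetzClass_mem_hodgeClasses j h) fun y hy ↦ ?_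
  obtain ⟨x, rfl⟩ := ((Q.isSymplectic_lefschetzClass hn hg).lefschetzPow_bijective hpj h).2 y
  exact ⟨x, Q.mem_divisorClasses_of_lefschetzPow_mem hn hg hpj.le h hy, rfl⟩

include Q hn hg in
/-- **`d_p = d_{g-p}` for `2p ≤ g`** (`E^{g-2p} ∧ · : Dᵖ ≅ D^{g-p}`). [cite: Milne1999LefschetzClasses, §5 Prop. 5.2 and Cor. 5.3 (a)]
[cite: Lange2023AbelianVarietiesComplex, §7.3.2 (1) (p. 338)] -/
theorem Polarization.finrank_divisorClasses_eq_of_le {p : ℕ} (hp : 2 * p ≤ g) :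
    Module.finrank ℚ ↥(H.divisorClasses p) = Module.finrank ℚ ↥(H.divisorClasses (g - p)) := by
  have h : 2 * (g - 2 * p) + 2 * p = 2 * (g - p) := by omega
  rw [← Q.map_lefschetzPow_divisorClasses_eq hn hg (j := g - 2 * p) (by omega) h]
  exact LinearEquiv.finrank_eq
    (Submodule.equivMapOfInjective _ ((Q.isSymplectic_lefschetzClass hn hg).lefschetzPow_injective (by omega) h) _)

include Q hn hg in
/-- **MILNE'S PROP. 5.2 ON THE CARRIER: for `p ≤ g` and `0 ≠ x ∈ Dᵖ(H)` there is `y ∈ D^{g-p}(H)` with `x ∧ y ≠ 0`** in `⋀^{2g} V ≅ ℚ`.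
Below the middle `y = E^{g-2p} ∧ z`, `z = Σ_r ± π_r x ∈ Dᵖ` with `Q_{2p}(x, z) = P(x, x) > 0` (positivity of the polarization of
`⋀^{2p} H` on the Hodge class `x`); above it `x = E^{2p-g} ∧ x'` with `x' ∈ D^{g-p}` (descent) and `y = Σ_r ± π_r x'`.
[cite: Milne1999LefschetzClasses, §5 Prop. 5.2 (p. 662)] [cite: Deligne1982HodgeCycles, I §2 Prop. 2.9 (b)(iii)] -/
theorem Polarization.exists_mem_divisorClasses_mul_ne_zero {p : ℕ} (hp : p ≤ g) {x : ⋀[ℚ]^(2 * p) V}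
    (hx : x ∈ H.divisorClasses p) (hx0 : x ≠ 0) :
    ∃ y ∈ H.divisorClasses (g - p), (x : ExteriorAlgebra ℚ V) * y ≠ 0 := by
  have hω := Q.isSymplectic_lefschetzClass hn hg
  have hq : ∀ a : ℕ, (a : ℤ) * n + (a : ℤ) * n = ((2 * a : ℕ) : ℤ) * n := fun a ↦ by push_cast; ring
  -- the pairing below the middle, for any degree `2a ≤ g`
  have key : ∀ {a : ℕ} (ha : 2 * a ≤ g) {u : ⋀[ℚ]^(2 * a) V}, u ∈ H.divisorClasses a → u ≠ 0 →
      ∃ z ∈ H.divisorClasses a, lefschetzForm (Q.lefschetzClass : ExteriorAlgebra ℚ V) g (2 * a) u z ≠ 0 := by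
    intro a ha u hu hu0
    refine ⟨_, Q.sum_smul_lefschetzProj_mem_divisorClasses hn hg ha hu, ?_⟩
    rw [Q.lefschetzForm_sum_smul_lefschetzProj hn hg ha u]
    exact mul_ne_zero (pow_ne_zero _ (by norm_num))
      ((Q.exteriorPower hn hg ha).form_self_pos_of_mem_hodgeClasses (hq a) (divisorClasses_le_hodgeClasses H a hu) hu0).ne'
  by_cases h2 : 2 * p ≤ g
  · obtain ⟨z, hz, hne⟩ := key h2 hx hx0
    have hjm : 2 * (g - 2 * p) + 2 * p = 2 * (g - p) := by omega
    refine ⟨lefschetzPow (Q.lefschetzClass : ExteriorAlgebra ℚ V) Q.lefschetzClass.2 (g - 2 * p) hjm z,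
      map_lefschetzPow_divisorClasses_le H Q.lefschetzClass_mem_hodgeClasses (g - 2 * p) hjm ⟨z, hz, rfl⟩, ?_⟩
    have hc : Commute ((Q.lefschetzClass : ExteriorAlgebra ℚ V) ^ (g - 2 * p)) (x : ExteriorAlgebra ℚ V) :=
      Commute.pow_left (mul_comm_of_mem_two Q.lefschetzClass.2 (x : ExteriorAlgebra ℚ V)) _
    intro h0
    apply hne
    rw [lefschetzForm_apply, ← mul_assoc, hc.eq, mul_assoc, ← lefschetzPow_apply_coe Q.lefschetzClass.2 (g - 2 * p) hjm z,
      h0, map_zero]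
  · rw [not_le] at h2
    have hk' : 2 * (g - p) ≤ g := by omega
    have hkj : 2 * (g - p) + (2 * p - g) = g := by omega
    have hm : 2 * (2 * p - g) + 2 * (g - p) = 2 * p := by omega
    obtain ⟨x', rfl⟩ := (hω.lefschetzPow_bijective hkj hm).2 x
    have hx' : x' ∈ H.divisorClasses (g - p) := Q.mem_divisorClasses_of_lefschetzPow_mem hn hg hkj.le hm hx
    have hx'0 : x' ≠ 0 := fun h ↦ hx0 (by rw [h, map_zero])
    obtain ⟨z, hz, hne⟩ := key hk' hx' hx'0
    refine ⟨z, hz, fun h0 ↦ hne ?_⟩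
    rw [lefschetzForm_apply, show g - 2 * (g - p) = 2 * p - g by omega, ← mul_assoc,
      ← lefschetzPow_apply_coe Q.lefschetzClass.2 (2 * p - g) hm x', h0, map_zero]

include Q hn hg in
/-- **MILNE'S COR. 5.3 (a) ON THE CARRIER (`D_hom = D_num`)**: a divisor class `x ∈ Dᵖ(H)`, `p ≤ g`, with `x ∧ y = 0` for all
`y ∈ D^{g-p}(H)` is zero. [cite: Milne1999LefschetzClasses, §5 Cor. 5.3 (a) (p. 663)] -/
theorem Polarization.eq_zero_of_forall_mul_divisorClasses_eq_zero {p : ℕ} (hp : p ≤ g) {x : ⋀[ℚ]^(2 * p) V}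
    (hx : x ∈ H.divisorClasses p) (h : ∀ y ∈ H.divisorClasses (g - p), (x : ExteriorAlgebra ℚ V) * y = 0) : x = 0 := by
  by_contra hx0
  obtain ⟨y, hy, hne⟩ := Q.exists_mem_divisorClasses_mul_ne_zero hn hg hp hx hx0
  exact hne (h y hy)

end DivisorClasses

end Literature.AlgebraicGeometry.Motives.HodgeStructure

end
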